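import Literature.MathematicalPhysics.QuantumFieldTheory.Balaban1983to89.B5Hk163TorusHolderRate
import Literature.MathematicalPhysics.QuantumFieldTheory.Balaban1983to89.B4Sect5Torus
import HarnessLib

/-!
# NE7TorusCombGaugeKit — integer and torus bookkeeping for the cone (comb) gauge on a discrete torus `Π_μ ℤ∕M_μ`:
# signed sums along the axes, CENTRED coordinates relative to a base point, and the Lipschitz walk of a cycle holonomy

Cell `pub-balaban`, rung (B)+1 sub-cell t4, lineage `b2b-balaban-t4-ne7-p1`, generation 65 (CRUX PROVER NE7 #1); hunt (h8) «REGULARITY ROAD»,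
step (h8-ii) LIN-ONE-STEP, file B1 of A ∕ B1 ∕ B2 ∕ C (memo `t4/b2b-balaban-t4-ne7-p1-g64/HUNT-H8-REGULARITY-ROAD.md` §4).

WHY.  The `C₁`-free curvature bound of [Balaban1985Variational] Thm 1 (8) rests, inside B11 Sect. F, on a generalized axial gauge centred at
a point `y` in which the gauge field grows at most LINEARLY in the distance from `y` times the sup of the curvature ((145) p. 301:
«|U′(x,x′) − 1| < |x − y|·2L²ε₀»).  File B2 proves the abelian torus version (a comb gauge with quadratic growth, the extra factor coming from
the bonds that wrap around the torus); THIS FILE supplies its def-free toolkit, every object entering as a HYPOTHESIS-CARRYING VARIABLE or an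
existential witness (no definitions are introduced):
* §1 SIGNED SUMS `zs f s = "Σ_{0 ≤ t < s} f t"` (`s ∈ ℤ`, negative `s` read backwards), characterised by `zs f 0 = 0`, `zs f (s+1) = zs f s + f s`:
  telescoping, additivity, the bound `|zs f s| ≤ |s|·sup|f|`, the PERIOD SHIFT `zs f (s − N) = zs f s − Σ_{t<N} f t` for `N`-periodic `f`, and
  existence of such a `zs` (`exists_signedSum`);
* §2 CENTRED REPRESENTATIVES `x + N·centre N x ∈ (−N∕2, N∕2]` (lit-balaban's `B4TorusKernel.MultiPeriod.centre`): uniqueness of centred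
  representatives, the successor dichotomy (step `+1`, or wrap `+1 − N` with `N ≤ 2x + 1`), and **`exists_centredCoords`**: for a base point `y₀`
  of the torus `Tor M` a coordinate map `s : Tor M → ℤ^{d+1}` with `y₀ + s(y) = y`, `s(y₀) = 0`, `s(y + e_ν)_i = s(y)_i (i ≠ ν)`, the successor
  dichotomy in coordinate `ν`, and `|s(y)_i| ≤ dist_T(y, y₀)` (`torusSupNorm`);
* §3 the TELESCOPE over the comb's later axes and the LIPSCHITZ WALK: a function on the torus whose unit steps are bounded by `K` moves by at
  most `|t|·K` along `t` steps.
HONEST FRAMING (page 1): [folklore] lattice bookkeeping; 0 def, 0 sorry; nothing of Bałaban's asserted; NOT ONE-STEP, NOT NE7; spine 0∕9; finite T⁴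
rung (B)+1 — NOT infinite volume, NOT mass gap, NOT Clay.  Continuum YM on T⁴ ⇐ BetaPertH ∧ nine spine estimates (0/9 proved); BetaPertH ⇐ (D1)
∧ (D4) ∧ CAP+tail; G-an2-4 gates asym, D1 and NE2/3/4.
-/

set_option autoImplicit false

noncomputable section

open Finset

namespace Summit.QuantumFields.BalabanUV.T4Continuum.NE7TorusCombGaugeKit

open Literature.MathematicalPhysics.QuantumFieldTheory.Balaban1983to89
open B4TorusKernel.MultiPeriod (torusSupNorm centre circAbs abs_add_mul_centre two_mul_circAbs_le circAbs_nonneg)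
open B5Prop11Plancherel (Tor unitVec)
open B6LowerBound2153Torus (toT rep toT_rep toT_add)
open B6Cov2156Torus (one_le_M)

/-! ## §1. Signed sums along an axis -/

section SignedSum

variable (zs : (ℤ → ℂ) → ℤ → ℂ)

/-- one step backwards: `zs f (s − 1) = zs f s − f (s − 1)`. [folklore] -/
theorem zs_pred (hzs : ∀ f s, zs f (s + 1) = zs f s + f s) (f : ℤ → ℂ) (s : ℤ) : zs f (s - 1) = zs f s - f (s - 1) := by
  have h := hzs f (s - 1)
  rw [sub_add_cancel] at h
  rw [h]; ring

/-- **telescoping**: `zs (t ↦ h(t+1) − h t) s = h s − h 0` for every `s ∈ ℤ`. [folklore] -/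
theorem zs_telescope (hz0 : ∀ f, zs f 0 = 0) (hzs : ∀ f s, zs f (s + 1) = zs f s + f s) (h : ℤ → ℂ) (s : ℤ) : zs (fun t => h (t + 1) - h t) s = h s - h 0 := by
  induction s using Int.induction_on with
  | zero => rw [hz0, sub_self]
  | succ n ih => rw [hzs, ih]; ring
  | pred n ih =>
    rw [zs_pred zs hzs, ih, sub_add_cancel]; ring

/-- additivity in the summand. [folklore] -/
theorem zs_add (hz0 : ∀ f, zs f 0 = 0) (hzs : ∀ f s, zs f (s + 1) = zs f s + f s) (f g : ℤ → ℂ) (s : ℤ) : zs (fun t => f t + g t) s = zs f s + zs g s := by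
  induction s using Int.induction_on with
  | zero => simp only [hz0, add_zero]
  | succ n ih => rw [hzs, hzs, hzs, ih]; ring
  | pred n ih =>
    rw [zs_pred zs hzs, zs_pred zs hzs f, zs_pred zs hzs g, ih]; ring

/-- compatibility with subtraction in the summand. [folklore] -/
theorem zs_sub (hz0 : ∀ f, zs f 0 = 0) (hzs : ∀ f s, zs f (s + 1) = zs f s + f s) (f g : ℤ → ℂ) (s : ℤ) : zs (fun t => f t - g t) s = zs f s - zs g s := by
  induction s using Int.induction_on with
  | zero => simp only [hz0, sub_zero]
  | succ n ih => rw [hzs, hzs, hzs, ih]; ring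
  | pred n ih =>
    rw [zs_pred zs hzs, zs_pred zs hzs f, zs_pred zs hzs g, ih]; ring

/-- **the bound**: `|zs f s| ≤ |s|·c` when `|f| ≤ c`. [folklore] -/
theorem norm_zs_le (hz0 : ∀ f, zs f 0 = 0) (hzs : ∀ f s, zs f (s + 1) = zs f s + f s) (f : ℤ → ℂ) {c : ℝ} (hf : ∀ t, ‖f t‖ ≤ c) (s : ℤ) : ‖zs f s‖ ≤ |(s : ℝ)| * c := by
  induction s using Int.induction_on with
  | zero => rw [hz0]; simp
  | succ n ih =>
    rw [hzs]
    refine (norm_add_le _ _).trans ?_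
    have e : |((((n : ℤ) + 1 : ℤ)) : ℝ)| = |((n : ℤ) : ℝ)| + 1 := by
      push_cast; rw [abs_of_nonneg (by positivity), abs_of_nonneg (by positivity)]
    rw [e, add_mul, one_mul]
    exact add_le_add ih (hf _)
  | pred n ih =>
    rw [zs_pred zs hzs]
    refine (norm_sub_le _ _).trans ?_
    have e : |(((-(n : ℤ) - 1 : ℤ)) : ℝ)| = |((-(n : ℤ) : ℤ) : ℝ)| + 1 := by
      push_cast
      rw [abs_of_nonpos (by linarith [(Nat.cast_nonneg n : (0 : ℝ) ≤ n)]),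
        abs_of_nonpos (by linarith [(Nat.cast_nonneg n : (0 : ℝ) ≤ n)])]
      ring
    rw [e, add_mul, one_mul]
    exact add_le_add ih (hf _)

/-- on naturals the signed sum is the ordinary one: `zs f N = Σ_{t<N} f t`. [folklore] -/
theorem zs_natCast (hz0 : ∀ f, zs f 0 = 0) (hzs : ∀ f s, zs f (s + 1) = zs f s + f s) (f : ℤ → ℂ) (N : ℕ) : zs f N = ∑ t ∈ Finset.range N, f t := by
  induction N with
  | zero => rw [Nat.cast_zero, hz0, Finset.sum_range_zero]
  | succ n ih => rw [Nat.cast_succ, hzs, ih, Finset.sum_range_succ]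

/-- **the period shift**: for an `N`-periodic summand, `zs f (s − N) = zs f s − Σ_{t<N} f t` (going once less around the cycle costs one
holonomy). [folklore] -/
theorem zs_sub_period (hz0 : ∀ f, zs f 0 = 0) (hzs : ∀ f s, zs f (s + 1) = zs f s + f s) (f : ℤ → ℂ) (N : ℕ) (hper : ∀ t, f (t + N) = f t) (s : ℤ) :
    zs f (s - N) = zs f s - ∑ t ∈ Finset.range N, f t := by
  -- the difference `zs f s − zs f (s − N)` is translation invariant
  have hstep : ∀ u : ℤ, zs f (u + 1) - zs f (u + 1 - N) = zs f u - zs f (u - N) := by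
    intro u
    have e : u + 1 - (N : ℤ) = (u - N) + 1 := by ring
    rw [e, hzs, hzs, ← hper (u - N), sub_add_cancel]; ring
  have hconst : ∀ u : ℤ, zs f u - zs f (u - N) = zs f 0 - zs f (0 - N) := by
    intro u
    induction u using Int.induction_on with
    | zero => rfl
    | succ n ih => rw [hstep, ih]
    | pred n ih =>
      have h := hstep (-(n : ℤ) - 1)
      rw [sub_add_cancel] at h
      rw [← ih, ← h]
  have hN := hconst N
  rw [zs_natCast zs hz0 hzs, sub_self, hz0] at hN
  have hs := hconst s
  rw [hz0] at hs
  linear_combination hN - hs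

/-- **existence of a signed sum**: `zs f s := Σ_{t < s⁺} f t − Σ_{t < (−s)⁺} f (−t − 1)`. [folklore] -/
theorem exists_signedSum : ∃ zs : (ℤ → ℂ) → ℤ → ℂ, (∀ f, zs f 0 = 0) ∧ ∀ f s, zs f (s + 1) = zs f s + f s := by
  refine ⟨fun f s => (∑ t ∈ Finset.range s.toNat, f t) - ∑ t ∈ Finset.range (-s).toNat, f (-(t : ℤ) - 1), ?_, ?_⟩
  · intro f; simp
  · intro f s
    rcases le_or_gt 0 s with hs | hs
    · obtain ⟨n, rfl⟩ := Int.eq_ofNat_of_zero_le hs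
      have e1 : ((n : ℤ) + 1).toNat = n + 1 := by
        rw [show (n : ℤ) + 1 = ((n + 1 : ℕ) : ℤ) by push_cast; ring, Int.toNat_natCast]
      have e2 : (-((n : ℤ) + 1)).toNat = 0 := by
        rw [show -((n : ℤ) + 1) = -((n + 1 : ℕ) : ℤ) by push_cast; ring, Int.toNat_neg_natCast]
      simp only [e1, e2, Int.toNat_natCast, Int.toNat_neg_natCast, Finset.sum_range_zero, sub_zero, Finset.sum_range_succ]
    · obtain ⟨n, hn⟩ := Int.exists_eq_neg_ofNat (le_of_lt hs)
      obtain ⟨m, rfl⟩ : ∃ m, n = m + 1 := by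
        rcases n with _ | m
        · simp at hn; omega
        · exact ⟨m, rfl⟩
      subst hn
      have e1 : (-((m + 1 : ℕ) : ℤ)).toNat = 0 := Int.toNat_neg_natCast _
      have e2 : (-((m + 1 : ℕ) : ℤ) + 1).toNat = 0 := by
        rw [show -((m + 1 : ℕ) : ℤ) + 1 = -((m : ℕ) : ℤ) by push_cast; ring, Int.toNat_neg_natCast]
      have e3 : (-(-((m + 1 : ℕ) : ℤ) + 1)).toNat = m := by
        rw [show -(-((m + 1 : ℕ) : ℤ) + 1) = ((m : ℕ) : ℤ) by push_cast; ring, Int.toNat_natCast]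
      have e4 : (-(-((m + 1 : ℕ) : ℤ))).toNat = m + 1 := by rw [neg_neg, Int.toNat_natCast]
      beta_reduce
      rw [e1, e2, e3, e4, Finset.sum_range_zero, Finset.sum_range_succ]
      have e5 : (-((m : ℕ) : ℤ) - 1 : ℤ) = -((m + 1 : ℕ) : ℤ) := by push_cast; ring
      rw [e5]; ring

end SignedSum

/-! ## §2. Centred representatives and centred coordinates on the torus -/

section Centred

/-- the centred representative `x + N·centre N x` lies in `(−N∕2, N∕2]`: `−N < 2(x + N·centre N x) ≤ N`. [folklore] -/
theorem centred_range {N : ℕ} (hN : 1 ≤ N) (x : ℤ) :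
    -(N : ℤ) < 2 * (x + N * centre N x) ∧ 2 * (x + N * centre N x) ≤ N := by
  have hdiv : (N : ℤ) * (x / (N : ℤ)) + x % (N : ℤ) = x := Int.mul_ediv_add_emod x (N : ℤ)
  have h0 : 0 ≤ x % (N : ℤ) := Int.emod_nonneg _ (by omega)
  have h1 : x % (N : ℤ) < N := Int.emod_lt_of_pos _ (by omega)
  unfold centre
  split_ifs with h
  · constructor <;> nlinarith
  · rw [not_le] at h
    constructor <;> nlinarith

/-- the centred representative is congruent to `x`. [folklore] -/
theorem dvd_centred_sub (N : ℕ) (x : ℤ) : (N : ℤ) ∣ (x + N * centre N x) - x :=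
  ⟨centre N x, by ring⟩

/-- **uniqueness of centred representatives**: two integers congruent mod `N`, both in `(−N∕2, N∕2]`, are equal. [folklore] -/
theorem eq_of_centred {N : ℕ} {a b : ℤ} (hab : (N : ℤ) ∣ a - b) (ha : -(N : ℤ) < 2 * a ∧ 2 * a ≤ N)
    (hb : -(N : ℤ) < 2 * b ∧ 2 * b ≤ N) : a = b := by
  have h : a - b = 0 := Int.eq_zero_of_abs_lt_dvd hab (by rw [abs_lt]; constructor <;> linarith [ha.1, ha.2, hb.1, hb.2])
  linarith

/-- the centred representative depends only on the class: congruent integers have the same one. [folklore] -/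
theorem centred_eq_of_dvd {N : ℕ} (hN : 1 ≤ N) {x x' : ℤ} (h : (N : ℤ) ∣ x - x') :
    x + N * centre N x = x' + N * centre N x' := by
  refine eq_of_centred ?_ (centred_range hN x) (centred_range hN x')
  have e : x + N * centre N x - (x' + N * centre N x') = (x - x') + N * (centre N x - centre N x') := by ring
  rw [e]
  exact dvd_add h ⟨_, rfl⟩

/-- centring is idempotent: the centred representative of a centred value is itself. [folklore] -/
theorem centred_of_centred {N : ℕ} {a : ℤ} (ha : -(N : ℤ) < 2 * a ∧ 2 * a ≤ N) (hN : 1 ≤ N) :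
    a + N * centre N a = a :=
  eq_of_centred (dvd_centred_sub N a) (centred_range hN a) ha

/-- `0` is centred: `0 + N·centre N 0 = 0`. [folklore] -/
theorem centred_zero (N : ℕ) : (0 : ℤ) + N * centre N 0 = 0 := by
  simp [centre]

/-- **THE SUCCESSOR DICHOTOMY**: for a centred `a`, the centred representative of `a + 1` is `a + 1` (no wrap) or `a + 1 − N`, and in the
wrap case `N ≤ 2a + 1`. [folklore] -/
theorem centred_succ {N : ℕ} (hN : 1 ≤ N) {a : ℤ} (ha : -(N : ℤ) < 2 * a ∧ 2 * a ≤ N) :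
    (a + 1) + N * centre N (a + 1) = a + 1 ∨
      ((a + 1) + N * centre N (a + 1) = a + 1 - N ∧ (N : ℤ) ≤ 2 * a + 1) := by
  rcases le_or_gt (2 * (a + 1)) N with h | h
  · left
    exact eq_of_centred (dvd_centred_sub N (a + 1)) (centred_range hN _) ⟨by linarith [ha.1], h⟩
  · right
    refine ⟨eq_of_centred ?_ (centred_range hN _) ⟨by linarith [ha.2], by linarith⟩, by linarith⟩
    have e : a + 1 + N * centre N (a + 1) - (a + 1 - N) = N * (centre N (a + 1) + 1) := by ring
    rw [e]; exact ⟨_, rfl⟩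

variable {d : ℕ} (M : Fin (d + 1) → ℕ) [hM : ∀ μ, NeZero (M μ)]

/-- **CENTRED COORDINATES RELATIVE TO A BASE POINT** (existence, def-free): for every `y₀ ∈ Tor M` there is `s : Tor M → ℤ^{d+1}` with
(i) `y₀ + s(y) = y` on the torus, (ii) `s(y₀) = 0`, (iii) `s(y + e_ν)_i = s(y)_i` for `i ≠ ν`, (iv) the successor dichotomy in coordinate `ν`:
`s(y + e_ν)_ν = s(y)_ν + 1`, or `= s(y)_ν + 1 − M_ν` with `M_ν ≤ 2s(y)_ν + 1`, (v) `|s(y)_i| ≤ dist_T(y, y₀) = torusSupNorm M (rep y − rep y₀)`.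
(Witness: `s(y)_i` = the centred representative of `rep y_i − rep y₀_i`.) [folklore] -/
theorem exists_centredCoords (y₀ : Tor M) :
    ∃ s : Tor M → (Fin (d + 1) → ℤ),
      (∀ y, y₀ + toT M (s y) = y) ∧ (s y₀ = 0) ∧
      (∀ y (ν i : Fin (d + 1)), i ≠ ν → s (y + unitVec M ν) i = s y i) ∧
      (∀ y (ν : Fin (d + 1)), s (y + unitVec M ν) ν = s y ν + 1 ∨
          (s (y + unitVec M ν) ν = s y ν + 1 - M ν ∧ (M ν : ℤ) ≤ 2 * s y ν + 1)) ∧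
      (∀ y (i : Fin (d + 1)), |((s y i : ℤ) : ℝ)| ≤ torusSupNorm M (rep M y - rep M y₀)) := by
  have hM1 : ∀ i, 1 ≤ M i := one_le_M M
  set s : Tor M → (Fin (d + 1) → ℤ) :=
    fun y i => (rep M y i - rep M y₀ i) + M i * centre (M i) (rep M y i - rep M y₀ i) with hs
  -- (i)
  have h1 : ∀ y, y₀ + toT M (s y) = y := by
    intro y; ext i
    simp only [hs, Pi.add_apply, toT, rep]
    push_cast
    simp
  -- the key: `s` reads off ANY integer representative of `y − y₀`
  have hkey : ∀ (y : Tor M) (z : Fin (d + 1) → ℤ), y₀ + toT M z = y →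
      ∀ i, s y i = z i + M i * centre (M i) (z i) := by
    intro y z hz i
    refine centred_eq_of_dvd (hM1 i) ?_
    rw [← ZMod.intCast_eq_intCast_iff_dvd_sub]
    have h := congr_fun hz i
    simp only [Pi.add_apply, toT] at h
    have e : ((rep M y i - rep M y₀ i : ℤ) : ZMod (M i)) = y i - y₀ i := by
      simp only [rep]; push_cast; simp
    rw [e, ← h]; ring
  refine ⟨s, h1, ?_, ?_, ?_, ?_⟩
  · -- (ii)
    ext i
    have h := hkey y₀ 0 (by rw [show toT M (0 : Fin (d + 1) → ℤ) = 0 from by ext j; simp [toT], add_zero]) i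
    rw [h, Pi.zero_apply, centred_zero]
  · -- (iii)
    intro y ν i hi
    have hz : y₀ + toT M (s y + Pi.single ν 1) = y + unitVec M ν := by
      rw [toT_add, ← add_assoc, h1 y]
      congr 1; ext j
      by_cases hj : j = ν
      · subst hj; simp [toT, unitVec]
      · simp [toT, unitVec, hj]
    rw [hkey _ _ hz i, Pi.add_apply, Pi.single_eq_of_ne hi, add_zero]
    exact centred_of_centred (centred_range (hM1 i) _) (hM1 i)
  · -- (iv)
    intro y ν
    have hz : y₀ + toT M (s y + Pi.single ν 1) = y + unitVec M ν := by
      rw [toT_add, ← add_assoc, h1 y]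
      congr 1; ext j
      by_cases hj : j = ν
      · subst hj; simp [toT, unitVec]
      · simp [toT, unitVec, hj]
    rw [hkey _ _ hz ν, Pi.add_apply, Pi.single_eq_same]
    exact centred_succ (hM1 ν) (centred_range (hM1 ν) _)
  · -- (v)
    intro y i
    have e : |s y i| = circAbs (M i) ((rep M y - rep M y₀) i) := abs_add_mul_centre (hM1 i) _
    rw [← Int.cast_abs, e]
    exact Finset.le_sup' (fun j => ((circAbs (M j) ((rep M y - rep M y₀) j) : ℤ) : ℝ)) (Finset.mem_univ i)

end Centred

/-! ## §3. The telescope over the later axes and the Lipschitz walk -/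

section Walk

variable {d : ℕ}

/-- **telescope over the comb's later axes**: `Σ_{i} [ (i = ν ? h(i+1)) + (ν < i ? h(i+1) − h(i)) ] = h(d+1)` (indices `i < d+1`). [folklore] -/
theorem sum_comb_telescope (h : ℕ → ℂ) (ν : Fin (d + 1)) :
    ∑ i : Fin (d + 1), ((if (i : ℕ) = ν then h (i + 1) else 0) + (if (ν : ℕ) < i then h (i + 1) - h i else 0)) = h (d + 1) := by
  rw [Fin.sum_univ_eq_sum_range (fun i => (if i = (ν : ℕ) then h (i + 1) else 0) + (if (ν : ℕ) < i then h (i + 1) - h i else 0))]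
  -- partial sums: `Σ_{i<n} = h n` for `n ≥ ν+1`
  have hP : ∀ n, (ν : ℕ) + 1 ≤ n →
      ∑ i ∈ Finset.range n, ((if i = (ν : ℕ) then h (i + 1) else 0) + (if (ν : ℕ) < i then h (i + 1) - h i else 0)) = h n := by
    refine Nat.le_induction ?_ ?_
    · rw [Finset.sum_range_succ, Finset.sum_eq_zero]
      · simp
      · intro i hi
        rw [Finset.mem_range] at hi
        rw [if_neg (by omega), if_neg (by omega), add_zero]
    · intro n hn ih
      rw [Finset.sum_range_succ, ih, if_neg (by omega), if_pos (by omega)]; ring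
  exact hP (d + 1) (by have := ν.isLt; omega)

variable (M : Fin (d + 1) → ℕ) [hM : ∀ μ, NeZero (M μ)]

omit hM in
/-- **the Lipschitz walk**: if every unit step of `G` in direction `e` costs at most `K`, then `t` steps cost at most `|t|·K`. [folklore] -/
theorem norm_walk_le (G : Tor M → ℂ) (e : Tor M) {K : ℝ} (hK : ∀ p, ‖G (p + e) - G p‖ ≤ K) (p : Tor M) (t : ℤ) :
    ‖G (p + t • e) - G p‖ ≤ |(t : ℝ)| * K := by
  induction t using Int.induction_on with
  | zero => simp
  | succ n ih =>
    have e1 : p + ((n : ℤ) + 1) • e = (p + (n : ℤ) • e) + e := by rw [add_one_zsmul, add_assoc]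
    have hn : |((((n : ℤ) + 1 : ℤ)) : ℝ)| = |((n : ℤ) : ℝ)| + 1 := by
      push_cast; rw [abs_of_nonneg (by positivity), abs_of_nonneg (by positivity)]
    rw [e1, hn, add_mul, one_mul]
    calc ‖G (p + (n : ℤ) • e + e) - G p‖
        = ‖(G (p + (n : ℤ) • e + e) - G (p + (n : ℤ) • e)) + (G (p + (n : ℤ) • e) - G p)‖ := by congr 1; ring
      _ ≤ ‖G (p + (n : ℤ) • e + e) - G (p + (n : ℤ) • e)‖ + ‖G (p + (n : ℤ) • e) - G p‖ := norm_add_le _ _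
      _ ≤ K + |((n : ℤ) : ℝ)| * K := add_le_add (hK _) ih
      _ = |((n : ℤ) : ℝ)| * K + K := by ring
  | pred n ih =>
    have e1 : p + (-(n : ℤ) - 1) • e + e = p + (-(n : ℤ)) • e := by
      rw [add_assoc, ← add_one_zsmul, sub_add_cancel]
    have hn : |(((-(n : ℤ) - 1 : ℤ)) : ℝ)| = |((-(n : ℤ) : ℤ) : ℝ)| + 1 := by
      push_cast
      rw [abs_of_nonpos (by linarith [(Nat.cast_nonneg n : (0 : ℝ) ≤ n)]),
        abs_of_nonpos (by linarith [(Nat.cast_nonneg n : (0 : ℝ) ≤ n)])]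
      ring
    rw [hn, add_mul, one_mul]
    calc ‖G (p + (-(n : ℤ) - 1) • e) - G p‖
        = ‖(G (p + (-(n : ℤ) - 1) • e) - G (p + (-(n : ℤ) - 1) • e + e))
            + (G (p + (-(n : ℤ) - 1) • e + e) - G p)‖ := by congr 1; ring
      _ ≤ ‖G (p + (-(n : ℤ) - 1) • e) - G (p + (-(n : ℤ) - 1) • e + e)‖
            + ‖G (p + (-(n : ℤ) - 1) • e + e) - G p‖ := norm_add_le _ _
      _ ≤ K + |((-(n : ℤ) : ℤ) : ℝ)| * K := by
          refine add_le_add ?_ ?_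
          · rw [norm_sub_rev]; exact hK _
          · rw [e1]; exact ih
      _ = |((-(n : ℤ) : ℤ) : ℝ)| * K + K := by ring

end Walk

end Summit.QuantumFields.BalabanUV.T4Continuum.NE7TorusCombGaugeKit
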